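import Literature.MathematicalPhysics.QuantumFieldTheory.Balaban1983to89.B9Eq326G1SupRowOfLetters

/-!
# `Balaban1983to89.B9Eq3130NeumannLetter` — T. Bałaban, *Propagators for lattice gauge theories in a background field*, Commun. Math. Phys. **99** (1985) 389–434
# [Balaban1985BackgroundPropagators] (3.130) p. 421 (*«G = G₀(I − Δ′_πG₀)⁻¹»* — the Hessian-slot perturbation from the bare-Hessian propagator `G₀` to the propagator
# of the gauge-invariant extension (3.122) ∕ (3.128)), p. 420–421 (*«… we will prove that this term is a small perturbation of Δ_a …»*), Thm 3.1 (3.42) p. 397, p. 415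
# (*«random walk expansion»*), with [Balaban1984PropagatorsII] Lemma 2.1 (2.61) p. 234: **THE LOCAL SUP LETTER (L) OF A RESOLVENT `T = G₀ + G₀∘D∘T` FROM THE LETTERS OF
# `G₀` AND `D` — A BOOTSTRAP ON AN A-PRIORI LETTER, NO INFINITE SUM: (L)(G₀; B₀, κ), (L)(D; B′, κ), any a-priori (L)(T; M, κ′) (`0 ≤ κ′ < κ`), one row constant
# `Σ_u e^{−(κ−κ′)δ(w,u)} ≤ K` and `q := B₀B′K² < 1` ⟹ (L)(T; B₀∕(1−q), κ′)** — the NE9 owner's request R-ne9p1-g96-5 (journal `HOME/CLAIMS.log` l.65707 (3):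
# «ONE generic lemma «(L)-letter of a Neumann series» (S, (K61)'s algebra + a geometric sum; first refusal leaf-05)»), in this lineage's (K61) letter algebra
# `B9Eq326G1SupRowOfLetters` §0 (one weighted carrier over a block lattice `(Y, δ, π)`, letters read through `WL2.equiv`)

statement-level skeleton of published theorems with citation tags; proofs where landed; nothing here is a claim about the Yang–Mills mass gap

CITATION HEADER (lean-in-tree rule).  Audit cell `pub-balaban`, sub-cell `t4`, BINDER row NE9; filed by NE9 crux-team LEAF PROVER 05
(`b2b-balaban-t4-ne9-formalise-leaf-05`, gen 87).  Composed BY NAME from (K61) `letter_comp`, `letter_mono` and `B4Sect5Torus.torusSum_le`; [folklore] real bookkeeping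
(`tendsto_pow_atTop_nhds_zero_of_lt_one`).  Source READ first-hand (`paper:balaban1985-cmp99-background-propagators`, journal page = PDF page + 388): p. 420–421 (3.128)–(3.130),
p. 397 (3.42).  Print sums the Neumann series of (3.130) with (3.42)-type kernel bounds; here the same geometric bookkeeping is run as a bootstrap on the resolvent identity,
so that no operator series is formed.  NOTHING of print's estimate of `Δ′_π` ((3.120), (3.36)) is here — that letter, (L)(Δ′_π,k; B′, κ), is the owner's (plan v13).

WHAT IS PROVED (sorry-free; proof lane — no `def`; [folklore]).
* §1 (abstract `(Y, δ, π)`, one carrier `WL2 𝕜 w V`, `G₀ D T` continuous linear endomorphisms)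
  **`letter_resolvent_step`** — `T f = G₀ f + G₀ (D (T f))` for all `f`, (L)(G₀; B₀, κ), (L)(D; B′, κ), (L)(T; M, κ′), `0 ≤ κ′ < κ`, `Σ_u e^{−(κ−κ′)δ(w,u)} ≤ K`
  ⟹ (L)(T; B₀ + (M·B′·K)·B₀·K, κ′) (the inner factor `T` at the target rate, `D` and `G₀` post-composed at rate `κ` by `letter_comp` — no further rate loss —, `G₀`
  alone weakened by `letter_mono`, triangle inequality);
  **`letter_of_neumann`** — `q < 1` ⟹ **(L)(T; B₀∕(1−q), κ′)** (`Σ_{j<N} qʲ ≤ (1−q)⁻¹` by `tsum_geometric_of_lt_one`, `q^N·M → 0`, `ge_of_tendsto'`);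
  **`exists_apriori_letter`** — on a finite carrier EVERY continuous linear `T` has SOME letter (L)(T; M, κ′) (`M` = operator norm × √(total mass) ∕ √(weight
  floor) × `e^{κ′·max δ}`), so **`letter_of_neumann'`** needs NO a-priori hypothesis;
  §1b **`le_of_bootstrap_iterates`** (the bare geometric limit, for systems of ≥ 3 rows inducted by the user); **`letter_bootstrap`** — the limit argument ABSTRACTED from the identity: an a-priori letter + a one-step improvement «(L)(S; M′) ⟹ (L)(S; b + qM′)» proved by
  the USER from whatever identity ∕ closed system holds (print's sandwich (3.131), source-side rows …), `q < 1` ⟹ (L)(S; b∕(1−q)); **`letter_bootstrap_pair`** — the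
  same for TWO rows improving TOGETHER (print's closed system (3.42)–(3.47): e.g. the value row of `G̃` and the divergence row `D*_UG̃`);
  **`letter_postcomp_resolvent`** — the post-composed form `PT = PG + PG∘D∘T` to ANY output carrier (gradient ∕ divergence members): (L)(PT; B_P + M_T·B′K·B_PK, κ′).
* §2 **`letter_of_neumann_torus`** — `Y = T_m`, `δ = d_m` (`1 ≤ m_i`): `K = K_d(κ−κ′)` by `torusSum_le`, VOLUME-FREE, no a-priori letter.
HONEST SCOPE.  Pure letter algebra; the a-priori letter `(L)(T; M, κ′)` of the bootstrap is of ANY size and is DISCHARGED on finite carriers (`exists_apriori_letter`) —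
the conclusion does not see `M`.  USE AND A CAVEAT (ne9-leaf-03 g79 W-3, journal l.65751, agreed): the slot `(L)(D; B′, κ)` with `D := ∓Δ′_π,k` is NOT inhabitable with a height-free `B′` in
the one-sided (L)-currency (`Δ′_π,k = −E†H − HE + E†HE`, `E = D_UG′_kR_kD*_U` differentiates the raw input); the `G₀ ↦ G̃` transfer of the NE9 crew's rows is to run
through `letter_bootstrap_pair` on the PAIR (value row of `G̃_k`, divergence row `D*_UG̃_k`) with a user-proved one-step improvement (resolvent identity +
(3.152)'s `RD*G̃ = RG′D*` + the curvature stencil, `O(α)` coefficients — the owner's plan v13), NOT through `letter_of_neumann` with `D := −Δ′_π,k`.  Nothing of [B9] (3.130), Thm 3.1∕3.3∕3.13 is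
asserted, valued or discharged; «NE9 ⇐ the named binders»; NE9 NOT PRINTED ∕ NOT PROVED; row WALLED ON A MODEL (O-NE9-1; #5 UNRULED); spine PROVED 0∕9; rung (B)+1 on a
finite T⁴ — NOT infinite volume, NOT mass gap, NOT BetaPertH, NOT Clay.  HONEST DEPENDENCY: continuum YM on T⁴ ⇐ BetaPertH ∧ nine spine estimates (0/9 proved); BetaPertH
⇐ (D1) ∧ (D4) ∧ CAP+tail; G-an2-4 gates asym, D1 and NE2/3/4.  NEW file importing (K61) only (BUILT); nothing modified.  Net new unproved facts: 0.
-/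

noncomputable section

set_option autoImplicit false

open scoped BigOperators
open Filter Topology

namespace Literature.MathematicalPhysics.QuantumFieldTheory.Balaban1983to89.B9Eq3130NeumannLetter

open B9Eq311L2Pairing (WL2)
open B4Sect5Torus (TSite tdist tdist_triangle tdist_nonneg torusSum_le)
open B4Sect5Proof (latticeConst latticeConst_nonneg)
open B9Eq326G1SupRowOfLetters (letter_comp letter_mono)

/-! ## §1 The resolvent bootstrap on an abstract block lattice -/

section Abstract

variable {𝕜 : Type*} [RCLike 𝕜] {Y : Type*} [Fintype Y] (δ : Y → Y → ℝ)
  {X : Type*} [Fintype X] [Nonempty X] {w : X → ℝ} [Fact (∀ x, 0 < w x)]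
  {V : Type*} [NormedAddCommGroup V] [InnerProductSpace 𝕜 V]
  (π : X → Y) (G₀ D T : WL2 𝕜 w V →L[𝕜] WL2 𝕜 w V)

/-- **ONE STEP OF THE BOOTSTRAP**: the resolvent identity `Tf = G₀f + G₀(D(Tf))`, (L)(G₀; B₀, κ), (L)(D; B′, κ), an a-priori (L)(T; M, κ′) with `0 ≤ κ′ < κ` and
the row constant `Σ_u e^{−(κ−κ′)δ(w,u)} ≤ K` ⟹ (L)(T; B₀ + M·B′·K·B₀·K, κ′) — the inner `T` at the target rate, `D` then `G₀` post-composed at the primitive rate by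
(K61) `letter_comp` (no further rate loss), `G₀` alone weakened by `letter_mono`. [folklore] [cite: Balaban1985BackgroundPropagators, (3.130) p.421, Thm 3.1 (3.42) p.397]
[cite: Balaban1984PropagatorsII, Lemma 2.1 (2.61) p.234] -/
theorem letter_resolvent_step (hδ0 : ∀ u v, 0 ≤ δ u v) (hδt : ∀ u y v, δ u v ≤ δ u y + δ y v)
    (hT : ∀ f, T f = G₀ f + G₀ (D (T f))) {B₀ B' M κ κ' K : ℝ} (hB₀ : 0 ≤ B₀) (hB' : 0 ≤ B') (hM : 0 ≤ M) (hκ' : 0 ≤ κ') (hκ : κ' < κ)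
    (hG : ∀ (v : Y) (f : WL2 𝕜 w V) (F : ℝ), (∀ x, π x ≠ v → WL2.equiv 𝕜 w V f x = 0) → (∀ x, ‖WL2.equiv 𝕜 w V f x‖ ≤ F) →
      ∀ x, ‖WL2.equiv 𝕜 w V (G₀ f) x‖ ≤ B₀ * Real.exp (-(κ * δ (π x) v)) * F)
    (hD : ∀ (v : Y) (f : WL2 𝕜 w V) (F : ℝ), (∀ x, π x ≠ v → WL2.equiv 𝕜 w V f x = 0) → (∀ x, ‖WL2.equiv 𝕜 w V f x‖ ≤ F) →
      ∀ x, ‖WL2.equiv 𝕜 w V (D f) x‖ ≤ B' * Real.exp (-(κ * δ (π x) v)) * F)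
    (hTM : ∀ (v : Y) (f : WL2 𝕜 w V) (F : ℝ), (∀ x, π x ≠ v → WL2.equiv 𝕜 w V f x = 0) → (∀ x, ‖WL2.equiv 𝕜 w V f x‖ ≤ F) →
      ∀ x, ‖WL2.equiv 𝕜 w V (T f) x‖ ≤ M * Real.exp (-(κ' * δ (π x) v)) * F)
    (hS : ∀ w', ∑ u, Real.exp (-((κ - κ') * δ w' u)) ≤ K)
    (v : Y) (f : WL2 𝕜 w V) (F : ℝ) (hfv : ∀ x, π x ≠ v → WL2.equiv 𝕜 w V f x = 0) (hfF : ∀ x, ‖WL2.equiv 𝕜 w V f x‖ ≤ F) (x : X) :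
    ‖WL2.equiv 𝕜 w V (T f) x‖ ≤ (B₀ + M * B' * K * B₀ * K) * Real.exp (-(κ' * δ (π x) v)) * F := by
  have hK : 0 ≤ K := (Finset.sum_nonneg fun u _ => Real.exp_nonneg _).trans (hS v)
  -- `D ∘ T` at the target rate, then `G₀ ∘ (D ∘ T)`
  have h₁ := letter_comp δ π π π T D hδ0 hδt hM hB' hκ' le_rfl hTM hD hS
  have h₂ := letter_comp δ π π π (D ∘L T) G₀ hδ0 hδt (by positivity : (0 : ℝ) ≤ M * B' * K) hB₀ hκ' le_rfl h₁ hG hS v f F hfv hfF x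
  have h₀ := letter_mono δ π π G₀ hδ0 hB₀ le_rfl hκ.le hG v f F hfv hfF x
  rw [hT f, WL2.equiv_add, Pi.add_apply]
  have e : G₀ (D (T f)) = (G₀ ∘L (D ∘L T)) f := rfl
  rw [e]
  calc _ ≤ ‖WL2.equiv 𝕜 w V (G₀ f) x‖ + ‖WL2.equiv 𝕜 w V ((G₀ ∘L (D ∘L T)) f) x‖ := norm_add_le _ _
    _ ≤ B₀ * Real.exp (-(κ' * δ (π x) v)) * F + M * B' * K * B₀ * K * Real.exp (-(κ' * δ (π x) v)) * F := add_le_add h₀ h₂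
    _ = _ := by ring

/-! ### §1b The bootstrap abstracted from the identity: ONE letter, and a PAIR of letters (print's closed system (3.42)–(3.47)) -/

omit [Fintype Y] in
/-- **THE GEOMETRIC LIMIT BEHIND EVERY BOOTSTRAP, EXPOSED** (for closed systems of THREE or more rows — print's (3.42)–(3.47) has value, gradient, divergence, curl —
induct the system yourself to the iterate bound `M_N = b·Σ_{j<N} qʲ + q^N·M` on every row, then conclude row by row with this): `0 ≤ b`, `0 ≤ q < 1`, `0 ≤ c`,
`t ≤ M_N·c` for all `N` ⟹ `t ≤ b∕(1−q)·c`. [folklore] [cite: Balaban1985BackgroundPropagators, (3.130)–(3.133) pp.421–422, Thm 3.1 (3.42)–(3.47) pp.397–398] -/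
theorem le_of_bootstrap_iterates {t b q M c : ℝ} (hb : 0 ≤ b) (hq0 : 0 ≤ q) (hq : q < 1) (hc : 0 ≤ c)
    (h : ∀ N : ℕ, t ≤ (b * (∑ j ∈ Finset.range N, q ^ j) + q ^ N * M) * c) : t ≤ b / (1 - q) * c := by
  have hgeom : ∀ N : ℕ, ∑ j ∈ Finset.range N, q ^ j ≤ 1 / (1 - q) := fun N => by
    rw [one_div, ← tsum_geometric_of_lt_one hq0 hq]
    exact (summable_geometric_of_lt_one hq0 hq).sum_le_tsum (Finset.range N) (fun j _ => pow_nonneg hq0 j)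
  have hN : ∀ N : ℕ, t ≤ (b / (1 - q) + M * q ^ N) * c := fun N => by
    refine (h N).trans (mul_le_mul_of_nonneg_right ?_ hc)
    have h1 : b * (∑ j ∈ Finset.range N, q ^ j) ≤ b / (1 - q) := by
      calc b * (∑ j ∈ Finset.range N, q ^ j) ≤ b * (1 / (1 - q)) := mul_le_mul_of_nonneg_left (hgeom N) hb
        _ = b / (1 - q) := by ring
    linarith [mul_comm M (q ^ N)]
  have hlim : Tendsto (fun N : ℕ => (b / (1 - q) + M * q ^ N) * c) atTop (𝓝 ((b / (1 - q) + M * 0) * c)) :=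
    (tendsto_const_nhds.add (tendsto_const_nhds.mul (tendsto_pow_atTop_nhds_zero_of_lt_one hq0 hq))).mul tendsto_const_nhds
  rw [mul_zero, add_zero] at hlim
  exact ge_of_tendsto' hlim hN

omit [Fintype Y] in
/-- **THE ABSTRACT BOOTSTRAP** — the limit argument of `letter_of_neumann` separated from the resolvent algebra: an a-priori letter (L)(T; M, κ′) (any size) and a
ONE-STEP IMPROVEMENT «(L)(T; M′, κ′) ⟹ (L)(T; b + q·M′, κ′) for every `M′ ≥ 0`» (to be proved by the user from WHATEVER identity or closed system the operator
satisfies — e.g. print's sandwich (3.131) with its source-side rows) with `0 ≤ q < 1` ⟹ (L)(T; b∕(1−q), κ′).  Output carrier arbitrary. [folklore]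
[cite: Balaban1985BackgroundPropagators, (3.130)–(3.131) p.421, Thm 3.1 (3.42)–(3.47) pp.397–398] -/
theorem letter_bootstrap {X₂ : Type*} [Fintype X₂] {w₂ : X₂ → ℝ} [Fact (∀ x, 0 < w₂ x)] {V₂ : Type*} [NormedAddCommGroup V₂] [InnerProductSpace 𝕜 V₂]
    (π₂ : X₂ → Y) (S : WL2 𝕜 w V →L[𝕜] WL2 𝕜 w₂ V₂) {b q M κ' : ℝ} (hb : 0 ≤ b) (hq0 : 0 ≤ q) (hq : q < 1) (hM : 0 ≤ M)
    (hSM : ∀ (v : Y) (f : WL2 𝕜 w V) (F : ℝ), (∀ x, π x ≠ v → WL2.equiv 𝕜 w V f x = 0) → (∀ x, ‖WL2.equiv 𝕜 w V f x‖ ≤ F) →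
      ∀ x, ‖WL2.equiv 𝕜 w₂ V₂ (S f) x‖ ≤ M * Real.exp (-(κ' * δ (π₂ x) v)) * F)
    (step : ∀ M' : ℝ, 0 ≤ M' →
      (∀ (v : Y) (f : WL2 𝕜 w V) (F : ℝ), (∀ x, π x ≠ v → WL2.equiv 𝕜 w V f x = 0) → (∀ x, ‖WL2.equiv 𝕜 w V f x‖ ≤ F) →
        ∀ x, ‖WL2.equiv 𝕜 w₂ V₂ (S f) x‖ ≤ M' * Real.exp (-(κ' * δ (π₂ x) v)) * F) →
      ∀ (v : Y) (f : WL2 𝕜 w V) (F : ℝ), (∀ x, π x ≠ v → WL2.equiv 𝕜 w V f x = 0) → (∀ x, ‖WL2.equiv 𝕜 w V f x‖ ≤ F) →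
        ∀ x, ‖WL2.equiv 𝕜 w₂ V₂ (S f) x‖ ≤ (b + q * M') * Real.exp (-(κ' * δ (π₂ x) v)) * F)
    (v : Y) (f : WL2 𝕜 w V) (F : ℝ) (hfv : ∀ x, π x ≠ v → WL2.equiv 𝕜 w V f x = 0) (hfF : ∀ x, ‖WL2.equiv 𝕜 w V f x‖ ≤ F) (x : X₂) :
    ‖WL2.equiv 𝕜 w₂ V₂ (S f) x‖ ≤ b / (1 - q) * Real.exp (-(κ' * δ (π₂ x) v)) * F := by
  obtain ⟨x₀⟩ := ‹Nonempty X›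
  have hF : 0 ≤ F := (norm_nonneg _).trans (hfF x₀)
  -- the iterates `M_N := b·Σ_{j<N} q^j + q^N·M`
  have hiter : ∀ N : ℕ, ∀ (v : Y) (f : WL2 𝕜 w V) (F : ℝ), (∀ x, π x ≠ v → WL2.equiv 𝕜 w V f x = 0) →
      (∀ x, ‖WL2.equiv 𝕜 w V f x‖ ≤ F) →
      ∀ x, ‖WL2.equiv 𝕜 w₂ V₂ (S f) x‖ ≤ (b * (∑ j ∈ Finset.range N, q ^ j) + q ^ N * M) * Real.exp (-(κ' * δ (π₂ x) v)) * F := by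
    intro N
    induction N with
    | zero => intro v f F hfv hfF x; simpa using hSM v f F hfv hfF x
    | succ N ih =>
      intro v f F hfv hfF x
      have hMN : 0 ≤ b * (∑ j ∈ Finset.range N, q ^ j) + q ^ N * M := by positivity
      have h := step _ hMN ih v f F hfv hfF x
      refine h.trans (le_of_eq ?_)
      have e : ∑ j ∈ Finset.range (N + 1), q ^ j = (∑ j ∈ Finset.range N, q ^ j) * q + 1 := by
        rw [Finset.sum_range_succ', pow_zero, Finset.sum_mul]
        simp_rw [pow_succ]
      rw [e, pow_succ]
      ring
  set E : ℝ := Real.exp (-(κ' * δ (π₂ x) v)) with hE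
  have hE0 : 0 ≤ E := Real.exp_nonneg _
  have hgeom : ∀ N : ℕ, ∑ j ∈ Finset.range N, q ^ j ≤ 1 / (1 - q) := fun N => by
    rw [one_div, ← tsum_geometric_of_lt_one hq0 hq]
    exact (summable_geometric_of_lt_one hq0 hq).sum_le_tsum (Finset.range N) (fun j _ => pow_nonneg hq0 j)
  have hN : ∀ N : ℕ, ‖WL2.equiv 𝕜 w₂ V₂ (S f) x‖ ≤ b / (1 - q) * E * F + (M * E * F) * q ^ N := by
    intro N
    have h := hiter N v f F hfv hfF x
    have h1 : b * (∑ j ∈ Finset.range N, q ^ j) ≤ b / (1 - q) := by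
      calc b * (∑ j ∈ Finset.range N, q ^ j) ≤ b * (1 / (1 - q)) := mul_le_mul_of_nonneg_left (hgeom N) hb
        _ = b / (1 - q) := by ring
    calc ‖WL2.equiv 𝕜 w₂ V₂ (S f) x‖ ≤ (b * (∑ j ∈ Finset.range N, q ^ j) + q ^ N * M) * E * F := h
      _ ≤ (b / (1 - q) + q ^ N * M) * E * F := mul_le_mul_of_nonneg_right (mul_le_mul_of_nonneg_right (add_le_add h1 le_rfl) hE0) hF
      _ = b / (1 - q) * E * F + (M * E * F) * q ^ N := by ring
  have hlim : Tendsto (fun N : ℕ => b / (1 - q) * E * F + (M * E * F) * q ^ N) atTop (𝓝 (b / (1 - q) * E * F + (M * E * F) * 0)) :=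
    tendsto_const_nhds.add (tendsto_const_nhds.mul (tendsto_pow_atTop_nhds_zero_of_lt_one hq0 hq))
  rw [mul_zero, add_zero] at hlim
  exact ge_of_tendsto' hlim hN

omit [Fintype Y] in
/-- **THE BOOTSTRAP FOR A PAIR OF LETTERS** (print's closed system: the value row and a second row — e.g. the divergence row `D*_UG̃` — improve TOGETHER): two maps
`S₁`, `S₂` out of the same source carrier (arbitrary output carriers), a common a-priori letter `M`, and a one-step improvement of the PAIR «(L)(S₁; M′) ∧ (L)(S₂; M′)
⟹ (L)(S₁; b + qM′) ∧ (L)(S₂; b + qM′)» with `0 ≤ q < 1` ⟹ both (L)(S_i; b∕(1−q), κ′).  (`b`, `q` = the maxima over the two rows of the user's 2×2 system.)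
[folklore] [cite: Balaban1985BackgroundPropagators, (3.130)–(3.133) pp.421–422, Thm 3.1 (3.42)–(3.47) pp.397–398] -/
theorem letter_bootstrap_pair {X₁ : Type*} [Fintype X₁] {w₁ : X₁ → ℝ} [Fact (∀ x, 0 < w₁ x)] {V₁ : Type*} [NormedAddCommGroup V₁]
    [InnerProductSpace 𝕜 V₁] {X₂ : Type*} [Fintype X₂] {w₂ : X₂ → ℝ} [Fact (∀ x, 0 < w₂ x)] {V₂ : Type*} [NormedAddCommGroup V₂]
    [InnerProductSpace 𝕜 V₂] (π₁ : X₁ → Y) (π₂ : X₂ → Y) (S₁ : WL2 𝕜 w V →L[𝕜] WL2 𝕜 w₁ V₁) (S₂ : WL2 𝕜 w V →L[𝕜] WL2 𝕜 w₂ V₂)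
    {b q M κ' : ℝ} (hb : 0 ≤ b) (hq0 : 0 ≤ q) (hq : q < 1) (hM : 0 ≤ M)
    (hSM₁ : ∀ (v : Y) (f : WL2 𝕜 w V) (F : ℝ), (∀ x, π x ≠ v → WL2.equiv 𝕜 w V f x = 0) → (∀ x, ‖WL2.equiv 𝕜 w V f x‖ ≤ F) →
      ∀ x, ‖WL2.equiv 𝕜 w₁ V₁ (S₁ f) x‖ ≤ M * Real.exp (-(κ' * δ (π₁ x) v)) * F)
    (hSM₂ : ∀ (v : Y) (f : WL2 𝕜 w V) (F : ℝ), (∀ x, π x ≠ v → WL2.equiv 𝕜 w V f x = 0) → (∀ x, ‖WL2.equiv 𝕜 w V f x‖ ≤ F) →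
      ∀ x, ‖WL2.equiv 𝕜 w₂ V₂ (S₂ f) x‖ ≤ M * Real.exp (-(κ' * δ (π₂ x) v)) * F)
    (step : ∀ M' : ℝ, 0 ≤ M' →
      (∀ (v : Y) (f : WL2 𝕜 w V) (F : ℝ), (∀ x, π x ≠ v → WL2.equiv 𝕜 w V f x = 0) → (∀ x, ‖WL2.equiv 𝕜 w V f x‖ ≤ F) →
        ∀ x, ‖WL2.equiv 𝕜 w₁ V₁ (S₁ f) x‖ ≤ M' * Real.exp (-(κ' * δ (π₁ x) v)) * F) →
      (∀ (v : Y) (f : WL2 𝕜 w V) (F : ℝ), (∀ x, π x ≠ v → WL2.equiv 𝕜 w V f x = 0) → (∀ x, ‖WL2.equiv 𝕜 w V f x‖ ≤ F) →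
        ∀ x, ‖WL2.equiv 𝕜 w₂ V₂ (S₂ f) x‖ ≤ M' * Real.exp (-(κ' * δ (π₂ x) v)) * F) →
      (∀ (v : Y) (f : WL2 𝕜 w V) (F : ℝ), (∀ x, π x ≠ v → WL2.equiv 𝕜 w V f x = 0) → (∀ x, ‖WL2.equiv 𝕜 w V f x‖ ≤ F) →
        ∀ x, ‖WL2.equiv 𝕜 w₁ V₁ (S₁ f) x‖ ≤ (b + q * M') * Real.exp (-(κ' * δ (π₁ x) v)) * F) ∧
      (∀ (v : Y) (f : WL2 𝕜 w V) (F : ℝ), (∀ x, π x ≠ v → WL2.equiv 𝕜 w V f x = 0) → (∀ x, ‖WL2.equiv 𝕜 w V f x‖ ≤ F) →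
        ∀ x, ‖WL2.equiv 𝕜 w₂ V₂ (S₂ f) x‖ ≤ (b + q * M') * Real.exp (-(κ' * δ (π₂ x) v)) * F)) :
    (∀ (v : Y) (f : WL2 𝕜 w V) (F : ℝ), (∀ x, π x ≠ v → WL2.equiv 𝕜 w V f x = 0) → (∀ x, ‖WL2.equiv 𝕜 w V f x‖ ≤ F) →
      ∀ x, ‖WL2.equiv 𝕜 w₁ V₁ (S₁ f) x‖ ≤ b / (1 - q) * Real.exp (-(κ' * δ (π₁ x) v)) * F) ∧
    (∀ (v : Y) (f : WL2 𝕜 w V) (F : ℝ), (∀ x, π x ≠ v → WL2.equiv 𝕜 w V f x = 0) → (∀ x, ‖WL2.equiv 𝕜 w V f x‖ ≤ F) →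
      ∀ x, ‖WL2.equiv 𝕜 w₂ V₂ (S₂ f) x‖ ≤ b / (1 - q) * Real.exp (-(κ' * δ (π₂ x) v)) * F) := by
  -- the PAIR iterates together: both rows carry `M_N := b·Σ_{j<N} q^j + q^N·M`
  have hiter : ∀ N : ℕ,
      (∀ (v : Y) (f : WL2 𝕜 w V) (F : ℝ), (∀ x, π x ≠ v → WL2.equiv 𝕜 w V f x = 0) → (∀ x, ‖WL2.equiv 𝕜 w V f x‖ ≤ F) →
        ∀ x, ‖WL2.equiv 𝕜 w₁ V₁ (S₁ f) x‖ ≤ (b * (∑ j ∈ Finset.range N, q ^ j) + q ^ N * M) * Real.exp (-(κ' * δ (π₁ x) v)) * F) ∧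
      (∀ (v : Y) (f : WL2 𝕜 w V) (F : ℝ), (∀ x, π x ≠ v → WL2.equiv 𝕜 w V f x = 0) → (∀ x, ‖WL2.equiv 𝕜 w V f x‖ ≤ F) →
        ∀ x, ‖WL2.equiv 𝕜 w₂ V₂ (S₂ f) x‖ ≤ (b * (∑ j ∈ Finset.range N, q ^ j) + q ^ N * M) * Real.exp (-(κ' * δ (π₂ x) v)) * F) := by
    intro N
    induction N with
    | zero => exact ⟨fun v f F hfv hfF x => by simpa using hSM₁ v f F hfv hfF x, fun v f F hfv hfF x => by simpa using hSM₂ v f F hfv hfF x⟩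
    | succ N ih =>
      have hMN : 0 ≤ b * (∑ j ∈ Finset.range N, q ^ j) + q ^ N * M := by positivity
      have h := step _ hMN ih.1 ih.2
      have e : ∑ j ∈ Finset.range (N + 1), q ^ j = (∑ j ∈ Finset.range N, q ^ j) * q + 1 := by
        rw [Finset.sum_range_succ', pow_zero, Finset.sum_mul]
        simp_rw [pow_succ]
      have e' : b + q * (b * (∑ j ∈ Finset.range N, q ^ j) + q ^ N * M) =
          b * (∑ j ∈ Finset.range (N + 1), q ^ j) + q ^ (N + 1) * M := by
        rw [e, pow_succ]; ring
      rw [← e']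
      exact h
  -- each row: the same geometric limit as the scalar bootstrap, on the pair iterates
  obtain ⟨x₀⟩ := ‹Nonempty X›
  have hgeom : ∀ N : ℕ, ∑ j ∈ Finset.range N, q ^ j ≤ 1 / (1 - q) := fun N => by
    rw [one_div, ← tsum_geometric_of_lt_one hq0 hq]
    exact (summable_geometric_of_lt_one hq0 hq).sum_le_tsum (Finset.range N) (fun j _ => pow_nonneg hq0 j)
  have hMN1 : ∀ N : ℕ, b * (∑ j ∈ Finset.range N, q ^ j) + q ^ N * M ≤ b / (1 - q) + M * q ^ N := fun N => by
    have h1 : b * (∑ j ∈ Finset.range N, q ^ j) ≤ b / (1 - q) := by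
      calc b * (∑ j ∈ Finset.range N, q ^ j) ≤ b * (1 / (1 - q)) := mul_le_mul_of_nonneg_left (hgeom N) hb
        _ = b / (1 - q) := by ring
    linarith [mul_comm M (q ^ N)]
  have hlim : Tendsto (fun N : ℕ => b / (1 - q) + M * q ^ N) atTop (𝓝 (b / (1 - q) + M * 0)) :=
    tendsto_const_nhds.add (tendsto_const_nhds.mul (tendsto_pow_atTop_nhds_zero_of_lt_one hq0 hq))
  rw [mul_zero, add_zero] at hlim
  have key : ∀ {t E F : ℝ}, 0 ≤ E → 0 ≤ F → (∀ N : ℕ, t ≤ (b * (∑ j ∈ Finset.range N, q ^ j) + q ^ N * M) * E * F) →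
      t ≤ b / (1 - q) * E * F := by
    intro t E F hE hF h
    have hN : ∀ N : ℕ, t ≤ (b / (1 - q) + M * q ^ N) * (E * F) := fun N =>
      (h N).trans (by rw [mul_assoc]; exact mul_le_mul_of_nonneg_right (hMN1 N) (mul_nonneg hE hF))
    have hlim' : Tendsto (fun N : ℕ => (b / (1 - q) + M * q ^ N) * (E * F)) atTop (𝓝 (b / (1 - q) * (E * F))) :=
      hlim.mul tendsto_const_nhds
    have := ge_of_tendsto' hlim' hN
    rw [mul_assoc]; exact this
  refine ⟨fun v f F hfv hfF x => ?_, fun v f F hfv hfF x => ?_⟩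
  · exact key (Real.exp_nonneg _) ((norm_nonneg _).trans (hfF x₀)) (fun N => (hiter N).1 v f F hfv hfF x)
  · exact key (Real.exp_nonneg _) ((norm_nonneg _).trans (hfF x₀)) (fun N => (hiter N).2 v f F hfv hfF x)


/-! ### §1c The resolvent -/

/-- **THE LETTER OF THE RESOLVENT** ((3.130) in the (L)-currency): `q := B′K·B₀K < 1` ⟹ **(L)(T; B₀∕(1−q), κ′)** — the a-priori constant `M` is gone
(`Σ_{j<N} qʲ ≤ (1−q)⁻¹`, `q^N·M → 0`, `le_of_tendsto'`). [folklore] [cite: Balaban1985BackgroundPropagators, (3.130) p.421, (3.120) p.419, Thm 3.1 (3.42) p.397]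
[cite: Balaban1984PropagatorsII, Lemma 2.1 (2.61) p.234] -/
theorem letter_of_neumann (hδ0 : ∀ u v, 0 ≤ δ u v) (hδt : ∀ u y v, δ u v ≤ δ u y + δ y v)
    (hT : ∀ f, T f = G₀ f + G₀ (D (T f))) {B₀ B' M κ κ' K : ℝ} (hB₀ : 0 ≤ B₀) (hB' : 0 ≤ B') (hM : 0 ≤ M) (hκ' : 0 ≤ κ') (hκ : κ' < κ)
    (hG : ∀ (v : Y) (f : WL2 𝕜 w V) (F : ℝ), (∀ x, π x ≠ v → WL2.equiv 𝕜 w V f x = 0) → (∀ x, ‖WL2.equiv 𝕜 w V f x‖ ≤ F) →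
      ∀ x, ‖WL2.equiv 𝕜 w V (G₀ f) x‖ ≤ B₀ * Real.exp (-(κ * δ (π x) v)) * F)
    (hD : ∀ (v : Y) (f : WL2 𝕜 w V) (F : ℝ), (∀ x, π x ≠ v → WL2.equiv 𝕜 w V f x = 0) → (∀ x, ‖WL2.equiv 𝕜 w V f x‖ ≤ F) →
      ∀ x, ‖WL2.equiv 𝕜 w V (D f) x‖ ≤ B' * Real.exp (-(κ * δ (π x) v)) * F)
    (hTM : ∀ (v : Y) (f : WL2 𝕜 w V) (F : ℝ), (∀ x, π x ≠ v → WL2.equiv 𝕜 w V f x = 0) → (∀ x, ‖WL2.equiv 𝕜 w V f x‖ ≤ F) →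
      ∀ x, ‖WL2.equiv 𝕜 w V (T f) x‖ ≤ M * Real.exp (-(κ' * δ (π x) v)) * F)
    (hS : ∀ w', ∑ u, Real.exp (-((κ - κ') * δ w' u)) ≤ K) (hq : B' * K * B₀ * K < 1)
    (v : Y) (f : WL2 𝕜 w V) (F : ℝ) (hfv : ∀ x, π x ≠ v → WL2.equiv 𝕜 w V f x = 0) (hfF : ∀ x, ‖WL2.equiv 𝕜 w V f x‖ ≤ F) (x : X) :
    ‖WL2.equiv 𝕜 w V (T f) x‖ ≤ B₀ / (1 - B' * K * B₀ * K) * Real.exp (-(κ' * δ (π x) v)) * F := by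
  have hK : 0 ≤ K := (Finset.sum_nonneg fun u _ => Real.exp_nonneg _).trans (hS v)
  refine letter_bootstrap δ π π T hB₀ (by positivity : (0 : ℝ) ≤ B' * K * B₀ * K) hq hM hTM (fun M' hM' h w g G hgv hgG y => ?_) v f F hfv hfF x
  have hs := letter_resolvent_step δ π G₀ D T hδ0 hδt hT hB₀ hB' hM' hκ' hκ hG hD h hS w g G hgv hgG y
  calc _ ≤ (B₀ + M' * B' * K * B₀ * K) * Real.exp (-(κ' * δ (π y) w)) * G := hs
    _ = (B₀ + B' * K * B₀ * K * M') * Real.exp (-(κ' * δ (π y) w)) * G := by ring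

/-- **AN A-PRIORI LETTER ALWAYS EXISTS ON A FINITE CARRIER** (any size): for every continuous linear `T` and `κ′ ≥ 0` there is `M ≥ 0` with
`‖(Tf)(x)‖ ≤ M·e^{−κ′δ(πx, v)}·F` whenever `‖f‖_∞ ≤ F` — operator norm × total mass ∕ weight floor × `e^{κ′·max δ}` (finite `X`, `Y`).  It feeds `letter_of_neumann`,
whose conclusion does not see `M`. [folklore] [cite: Balaban1985BackgroundPropagators, (3.130) p.421, (3.11) p.392] -/
theorem exists_apriori_letter {κ' : ℝ} (hκ' : 0 ≤ κ') :
    ∃ M : ℝ, 0 ≤ M ∧ ∀ (v : Y) (f : WL2 𝕜 w V) (F : ℝ), (∀ x, ‖WL2.equiv 𝕜 w V f x‖ ≤ F) →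
      ∀ x, ‖WL2.equiv 𝕜 w V (T f) x‖ ≤ M * Real.exp (-(κ' * δ (π x) v)) * F := by
  classical
  obtain ⟨x₀⟩ := ‹Nonempty X›
  haveI : Nonempty Y := ⟨π x₀⟩
  have hw : ∀ x, 0 < w x := Fact.out
  -- the largest distance, the smallest weight, the total mass
  obtain ⟨p₀, hp₀⟩ := Finite.exists_max (fun p : Y × Y => δ p.1 p.2)
  obtain ⟨x₁, hx₁⟩ := Finite.exists_min w
  set Dm : ℝ := δ p₀.1 p₀.2 with hDm
  set ω : ℝ := w x₁ with hω
  have hω0 : 0 < ω := hw x₁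
  set Wt : ℝ := ∑ x, w x with hWt
  have hWt0 : 0 ≤ Wt := Finset.sum_nonneg fun x _ => (hw x).le
  refine ⟨‖T‖ * Real.sqrt Wt / Real.sqrt ω * Real.exp (κ' * Dm), by positivity, ?_⟩
  intro v f F hfF x
  have hF : 0 ≤ F := (norm_nonneg _).trans (hfF x₀)
  -- `‖f‖ ≤ √Wt·F`
  have hf2 : ‖f‖ ^ 2 ≤ (Real.sqrt Wt * F) ^ 2 := by
    rw [WL2.norm_sq (𝕜 := 𝕜) (w := w) (V := V), mul_pow, Real.sq_sqrt hWt0, hWt, Finset.sum_mul]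
    exact Finset.sum_le_sum fun y _ => mul_le_mul_of_nonneg_left (pow_le_pow_left₀ (norm_nonneg _) (hfF y) 2) (hw y).le
  have hf : ‖f‖ ≤ Real.sqrt Wt * F := (pow_le_pow_iff_left₀ (norm_nonneg _) (by positivity) two_ne_zero).1 hf2
  -- `√ω·‖(Tf)(x)‖ ≤ ‖Tf‖ ≤ ‖T‖·‖f‖`
  have h1 := WL2.weight_mul_norm_sq_apply_le (𝕜 := 𝕜) (w := w) (T f) x
  have h2 : w x * ‖WL2.equiv 𝕜 w V (T f) x‖ ^ 2 ≤ (‖T‖ * (Real.sqrt Wt * F)) ^ 2 :=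
    h1.trans (pow_le_pow_left₀ (norm_nonneg _) ((T.le_opNorm f).trans (mul_le_mul_of_nonneg_left hf (norm_nonneg _))) 2)
  have h3 : ω * ‖WL2.equiv 𝕜 w V (T f) x‖ ^ 2 ≤ (‖T‖ * (Real.sqrt Wt * F)) ^ 2 :=
    (mul_le_mul_of_nonneg_right (hx₁ x) (sq_nonneg _)).trans h2
  have h4 : (Real.sqrt ω * ‖WL2.equiv 𝕜 w V (T f) x‖) ^ 2 ≤ (‖T‖ * (Real.sqrt Wt * F)) ^ 2 := by
    rw [mul_pow, Real.sq_sqrt hω0.le]; exact h3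
  have h5 : Real.sqrt ω * ‖WL2.equiv 𝕜 w V (T f) x‖ ≤ ‖T‖ * (Real.sqrt Wt * F) :=
    (pow_le_pow_iff_left₀ (by positivity) (by positivity) two_ne_zero).1 h4
  have hsω : 0 < Real.sqrt ω := Real.sqrt_pos.2 hω0
  have h6 : ‖WL2.equiv 𝕜 w V (T f) x‖ ≤ ‖T‖ * Real.sqrt Wt / Real.sqrt ω * F := by
    have h := (le_div_iff₀ hsω).2 ((mul_comm _ _).trans_le h5)
    calc ‖WL2.equiv 𝕜 w V (T f) x‖ ≤ ‖T‖ * (Real.sqrt Wt * F) / Real.sqrt ω := h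
      _ = ‖T‖ * Real.sqrt Wt / Real.sqrt ω * F := by ring
  -- the exponential is at least `e^{−κ′·Dm}`
  have hδle : δ (π x) v ≤ Dm := hp₀ (π x, v)
  have hexp : Real.exp (-(κ' * Dm)) ≤ Real.exp (-(κ' * δ (π x) v)) :=
    Real.exp_le_exp.2 (neg_le_neg (mul_le_mul_of_nonneg_left hδle hκ'))
  calc ‖WL2.equiv 𝕜 w V (T f) x‖ ≤ ‖T‖ * Real.sqrt Wt / Real.sqrt ω * F := h6
    _ = ‖T‖ * Real.sqrt Wt / Real.sqrt ω * Real.exp (κ' * Dm) * Real.exp (-(κ' * Dm)) * F := by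
        rw [mul_assoc (‖T‖ * Real.sqrt Wt / Real.sqrt ω), ← Real.exp_add, add_neg_cancel, Real.exp_zero, mul_one]
    _ ≤ ‖T‖ * Real.sqrt Wt / Real.sqrt ω * Real.exp (κ' * Dm) * Real.exp (-(κ' * δ (π x) v)) * F :=
        mul_le_mul_of_nonneg_right (mul_le_mul_of_nonneg_left hexp (by positivity)) hF

/-- **THE LETTER OF THE RESOLVENT WITH NO A-PRIORI HYPOTHESIS**: `letter_of_neumann` fed with `exists_apriori_letter` — on a finite carrier the resolvent identity,
(L)(G₀; B₀, κ), (L)(D; B′, κ), `0 ≤ κ′ < κ`, `Σ_u e^{−(κ−κ′)δ(w,u)} ≤ K` and `B′K·B₀K < 1` ALONE give (L)(T; B₀∕(1 − B′K·B₀K), κ′). [folklore]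
[cite: Balaban1985BackgroundPropagators, (3.130) p.421, Thm 3.1 (3.42) p.397] [cite: Balaban1984PropagatorsII, Lemma 2.1 (2.61) p.234] -/
theorem letter_of_neumann' (hδ0 : ∀ u v, 0 ≤ δ u v) (hδt : ∀ u y v, δ u v ≤ δ u y + δ y v)
    (hT : ∀ f, T f = G₀ f + G₀ (D (T f))) {B₀ B' κ κ' K : ℝ} (hB₀ : 0 ≤ B₀) (hB' : 0 ≤ B') (hκ' : 0 ≤ κ') (hκ : κ' < κ)
    (hG : ∀ (v : Y) (f : WL2 𝕜 w V) (F : ℝ), (∀ x, π x ≠ v → WL2.equiv 𝕜 w V f x = 0) → (∀ x, ‖WL2.equiv 𝕜 w V f x‖ ≤ F) →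
      ∀ x, ‖WL2.equiv 𝕜 w V (G₀ f) x‖ ≤ B₀ * Real.exp (-(κ * δ (π x) v)) * F)
    (hD : ∀ (v : Y) (f : WL2 𝕜 w V) (F : ℝ), (∀ x, π x ≠ v → WL2.equiv 𝕜 w V f x = 0) → (∀ x, ‖WL2.equiv 𝕜 w V f x‖ ≤ F) →
      ∀ x, ‖WL2.equiv 𝕜 w V (D f) x‖ ≤ B' * Real.exp (-(κ * δ (π x) v)) * F)
    (hS : ∀ w', ∑ u, Real.exp (-((κ - κ') * δ w' u)) ≤ K) (hq : B' * K * B₀ * K < 1)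
    (v : Y) (f : WL2 𝕜 w V) (F : ℝ) (hfv : ∀ x, π x ≠ v → WL2.equiv 𝕜 w V f x = 0) (hfF : ∀ x, ‖WL2.equiv 𝕜 w V f x‖ ≤ F) (x : X) :
    ‖WL2.equiv 𝕜 w V (T f) x‖ ≤ B₀ / (1 - B' * K * B₀ * K) * Real.exp (-(κ' * δ (π x) v)) * F := by
  obtain ⟨M, hM, hTM⟩ := exists_apriori_letter δ π T hκ'
  exact letter_of_neumann δ π G₀ D T hδ0 hδt hT hB₀ hB' hM hκ' hκ hG hD (fun v f F _ hfF x => hTM v f F hfF x) hS hq v f F hfv hfF x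

/-- **POST-COMPOSED FORM** (the gradient ∕ divergence members): for continuous linear `PG : X → X₂` (e.g. `D_U∘G₀`, `D*_U∘G₀`) and `PT` with the pointwise
identity `PT f = PG f + PG (D (T f))` (from `T = G₀ + G₀DT` post-composed by `P`), (L)(PG; B_P, κ) to ANY output carrier `(w₂, π₂)`, (L)(D; B′, κ) and the letter
(L)(T; M_T, κ′) delivered by `letter_of_neumann` ⟹ (L)(PT; B_P + M_T·B′·K·B_P·K, κ′). [folklore] [cite: Balaban1985BackgroundPropagators, (3.130) p.421, Thm 3.1 (3.42)
p.397, Thm 3.13 p.426] [cite: Balaban1984PropagatorsII, Lemma 2.1 (2.61) p.234] -/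
theorem letter_postcomp_resolvent {X₂ : Type*} [Fintype X₂] {w₂ : X₂ → ℝ} [Fact (∀ x, 0 < w₂ x)] {V₂ : Type*} [NormedAddCommGroup V₂]
    [InnerProductSpace 𝕜 V₂] (π₂ : X₂ → Y) (PG PT : WL2 𝕜 w V →L[𝕜] WL2 𝕜 w₂ V₂)
    (hδ0 : ∀ u v, 0 ≤ δ u v) (hδt : ∀ u y v, δ u v ≤ δ u y + δ y v)
    (hPT : ∀ f, PT f = PG f + PG (D (T f))) {BP B' MT κ κ' K : ℝ} (hBP : 0 ≤ BP) (hB' : 0 ≤ B') (hMT : 0 ≤ MT) (hκ' : 0 ≤ κ') (hκ : κ' < κ)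
    (hPG : ∀ (v : Y) (f : WL2 𝕜 w V) (F : ℝ), (∀ x, π x ≠ v → WL2.equiv 𝕜 w V f x = 0) → (∀ x, ‖WL2.equiv 𝕜 w V f x‖ ≤ F) →
      ∀ x, ‖WL2.equiv 𝕜 w₂ V₂ (PG f) x‖ ≤ BP * Real.exp (-(κ * δ (π₂ x) v)) * F)
    (hD : ∀ (v : Y) (f : WL2 𝕜 w V) (F : ℝ), (∀ x, π x ≠ v → WL2.equiv 𝕜 w V f x = 0) → (∀ x, ‖WL2.equiv 𝕜 w V f x‖ ≤ F) →
      ∀ x, ‖WL2.equiv 𝕜 w V (D f) x‖ ≤ B' * Real.exp (-(κ * δ (π x) v)) * F)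
    (hTM : ∀ (v : Y) (f : WL2 𝕜 w V) (F : ℝ), (∀ x, π x ≠ v → WL2.equiv 𝕜 w V f x = 0) → (∀ x, ‖WL2.equiv 𝕜 w V f x‖ ≤ F) →
      ∀ x, ‖WL2.equiv 𝕜 w V (T f) x‖ ≤ MT * Real.exp (-(κ' * δ (π x) v)) * F)
    (hS : ∀ w', ∑ u, Real.exp (-((κ - κ') * δ w' u)) ≤ K)
    (v : Y) (f : WL2 𝕜 w V) (F : ℝ) (hfv : ∀ x, π x ≠ v → WL2.equiv 𝕜 w V f x = 0) (hfF : ∀ x, ‖WL2.equiv 𝕜 w V f x‖ ≤ F) (x : X₂) :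
    ‖WL2.equiv 𝕜 w₂ V₂ (PT f) x‖ ≤ (BP + MT * B' * K * BP * K) * Real.exp (-(κ' * δ (π₂ x) v)) * F := by
  have hK : 0 ≤ K := (Finset.sum_nonneg fun u _ => Real.exp_nonneg _).trans (hS v)
  have h₁ := letter_comp δ π π π T D hδ0 hδt hMT hB' hκ' le_rfl hTM hD hS
  have h₂ := letter_comp δ π π π₂ (D ∘L T) PG hδ0 hδt (by positivity : (0 : ℝ) ≤ MT * B' * K) hBP hκ' le_rfl h₁ hPG hS v f F hfv hfF x
  have h₀ := letter_mono δ π π₂ PG hδ0 hBP le_rfl hκ.le hPG v f F hfv hfF x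
  rw [hPT f, WL2.equiv_add, Pi.add_apply]
  have e : PG (D (T f)) = (PG ∘L (D ∘L T)) f := rfl
  rw [e]
  calc _ ≤ ‖WL2.equiv 𝕜 w₂ V₂ (PG f) x‖ + ‖WL2.equiv 𝕜 w₂ V₂ ((PG ∘L (D ∘L T)) f) x‖ := norm_add_le _ _
    _ ≤ BP * Real.exp (-(κ' * δ (π₂ x) v)) * F + MT * B' * K * BP * K * Real.exp (-(κ' * δ (π₂ x) v)) * F := add_le_add h₀ h₂
    _ = _ := by ring

end Abstract

/-! ## §2 Over the coarse torus `T_m`: the row constant discharged (volume-free) -/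

section Lattice

variable {𝕜 : Type*} [RCLike 𝕜] {X : Type*} [Fintype X] [Nonempty X] {d : ℕ} {m : Fin d → ℕ}
  {w : X → ℝ} [Fact (∀ x, 0 < w x)] {V : Type*} [NormedAddCommGroup V] [InnerProductSpace 𝕜 V]
  (π : X → TSite d m) (G₀ D T : WL2 𝕜 w V →L[𝕜] WL2 𝕜 w V)

/-- **THE LETTER OF THE RESOLVENT OVER THE COARSE TORUS** (`δ = d_m`, `K = K_d(κ−κ′)` by `torusSum_le`, `1 ≤ m_i`, VOLUME-FREE; NO a-priori letter asked —
`exists_apriori_letter`): the resolvent identity, (L)(G₀; B₀, κ), (L)(D; B′, κ), `0 ≤ κ′ < κ`, `B′K_d(κ−κ′)·B₀K_d(κ−κ′) < 1` ⟹ (L)(T; B₀∕(1 − B′K·B₀K), κ′) — the form in which the NE9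
crew's `G₀`-rows transfer to print's `G̃` of (3.122)∕(3.128) once (L)(Δ′_π) is typed. [folklore] [cite: Balaban1985BackgroundPropagators, (3.130) p.421, (3.128) p.421,
Thm 3.1 (3.42) p.397] [cite: Balaban1984PropagatorsII, Lemma 2.1 (2.61) p.234] -/
theorem letter_of_neumann_torus (hm : ∀ i, 1 ≤ m i) (hT : ∀ f, T f = G₀ f + G₀ (D (T f))) {B₀ B' κ κ' : ℝ} (hB₀ : 0 ≤ B₀) (hB' : 0 ≤ B')
    (hκ' : 0 ≤ κ') (hκ : κ' < κ)
    (hG : ∀ (v : TSite d m) (f : WL2 𝕜 w V) (F : ℝ), (∀ x, π x ≠ v → WL2.equiv 𝕜 w V f x = 0) → (∀ x, ‖WL2.equiv 𝕜 w V f x‖ ≤ F) →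
      ∀ x, ‖WL2.equiv 𝕜 w V (G₀ f) x‖ ≤ B₀ * Real.exp (-(κ * tdist m (π x) v)) * F)
    (hD : ∀ (v : TSite d m) (f : WL2 𝕜 w V) (F : ℝ), (∀ x, π x ≠ v → WL2.equiv 𝕜 w V f x = 0) → (∀ x, ‖WL2.equiv 𝕜 w V f x‖ ≤ F) →
      ∀ x, ‖WL2.equiv 𝕜 w V (D f) x‖ ≤ B' * Real.exp (-(κ * tdist m (π x) v)) * F)
    (hq : B' * latticeConst d (κ - κ') * B₀ * latticeConst d (κ - κ') < 1)
    (v : TSite d m) (f : WL2 𝕜 w V) (F : ℝ) (hfv : ∀ x, π x ≠ v → WL2.equiv 𝕜 w V f x = 0) (hfF : ∀ x, ‖WL2.equiv 𝕜 w V f x‖ ≤ F) (x : X) :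
    ‖WL2.equiv 𝕜 w V (T f) x‖ ≤
      B₀ / (1 - B' * latticeConst d (κ - κ') * B₀ * latticeConst d (κ - κ')) * Real.exp (-(κ' * tdist m (π x) v)) * F :=
  letter_of_neumann' (tdist m) π G₀ D T (tdist_nonneg m) (fun u y w' => tdist_triangle hm u y w') hT hB₀ hB' hκ' hκ hG hD
    (fun w' => torusSum_le d hm (sub_pos.2 hκ) w') hq v f F hfv hfF x

end Lattice

end Literature.MathematicalPhysics.QuantumFieldTheory.Balaban1983to89.B9Eq3130NeumannLetter

end
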